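import Literature.Computability.Complexity.Transducers
import Literature.Computability.Complexity.TM2Iterate
import Literature.Computability.Complexity.UnaryArithMachines
import HarnessLib

/-!
# Stack register machines run in polynomial time on Mathlib's `TM2` model

Trunk `CplxCore`, toolkit for `TimeBounds.lean`. A **stack register machine** with `K`
registers, each holding a bit string (a stack of Booleans), executes a flat program of
instructions

* `push k b` — push the bit `b` on register `k`, fall through;
* `pop k jt jf jn` — pop register `k` and jump to `jt` / `jf` according to the popped bit, or to
  `jn` (leaving the register unchanged) if it is empty;
* `goto j`;

a program counter at or beyond the end of the program means *halted* (the step function is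
then the identity). This is the classical machine model of "counter/stack programs"
(Minsky 1967, Ch. 11 and 14: program machines, and machines with push-down registers over a
binary alphabet), which is polynomially equivalent to multi-tape Turing machines. This file
proves the direction needed to *establish* polynomial running times of concrete algorithms in
the tree's `TM2`-based classes without building Turing machines by hand:

* `SProg.step` — the (total) one-step semantics; `SProg.enc` — the tape encoding of a
  configuration: the (clamped) program counter as one symbol, then for each register a
  separator followed by its bits;
* `SProg.stepFST`, `SProg.stepFST_eval` — one machine step is a finite-state transduction of
  the encoded configuration, hence (`Transducers.lean`) `SProg.polyTime_step`: `step` is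
  `PolyTimeComputable enc enc`, and `SProg.length_enc_step_le`: it lengthens the encoding by at
  most one symbol;
* `SProg.outputFn_mem_FP` — **main result**: for every program `P` on `K + 1` registers, every
  output register `out` and every polynomial `T`, the string function
  `z ↦ (register out of step^[|z| + T(|z|)] (init z))`, where `init z` starts the program at
  instruction `0` with `z` in the last register and all other registers empty, is in `FP`.
  The machine is assembled from the tree's toolkit: the bit-doubling transducer and the unary
  clock `evalHdrFn T` (`UnaryArithMachines.lean`) prepare the iteration count in unary, a
  transducer lays out the initial configuration, `PolyTimeComputable.iterate_of_le_add`
  (`TM2Iterate.lean`) runs the clocked loop, a last transducer extracts the output register;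
  the stages are composed by `PolyTimeComputable.comp_holds`.

Structured programs compiling to this machine, with a compositional cost semantics, are in
`StackPrograms.lean`; together they reduce "`f ∈ FP`" to exhibiting a program and a polynomial
bound on its cost.

## References

* M. L. Minsky, *Computation: Finite and Infinite Machines*, Prentice-Hall 1967, §11.1
  (program machines), §14.1 (registers as push-down stores over `{0,1}`). (Not held; the model
  is standard.)
* S. Arora, B. Barak, *Computational Complexity: A Modern Approach*, CUP 2009, §1.3–1.4
  (robustness of polynomial time under change of machine model; clocked simulation).
-/

namespace Literature.Computability.Complexity

open _root_.Computability

/-! ### Stack register machines: syntax and one-step semantics -/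

/-- Instructions of a stack register machine with `K` binary stack registers: `push k b`
(then fall through), `pop k jt jf jn` (pop register `k`; jump to `jt`/`jf` on a popped
`true`/`false`, to `jn` if the register is empty), `goto j`. Jump targets are absolute
instruction numbers. [Minsky 1967, §11.1, §14.1] [folklore] -/
inductive SInstr (K : ℕ) where
  | push (k : Fin K) (b : Bool) : SInstr K
  | pop (k : Fin K) (jt jf jn : ℕ) : SInstr K
  | goto (j : ℕ) : SInstr K

/-- Configurations: program counter and register contents (head of the list = top of the
stack). [Minsky 1967, §11.1] [folklore] -/
structure SCfg (K : ℕ) where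
  /-- program counter (any value `≥` program length means: halted) -/
  pc : ℕ
  /-- register contents -/
  regs : Fin K → List Bool

/-- A stack register program: a list of instructions (instruction `i` at position `i`).
[Minsky 1967, §11.1] [folklore] -/
abbrev SProg (K : ℕ) := List (SInstr K)

namespace SProg

variable {K : ℕ} (P : SProg K)

/-- One step of the machine (total: a halted configuration, `pc ≥ |P|`, is fixed).
[Minsky 1967, §11.1, §14.1] [folklore] -/
def step (c : SCfg K) : SCfg K :=
  match P[c.pc]? with
  | none => c
  | some (.push k b) => ⟨c.pc + 1, Function.update c.regs k (b :: c.regs k)⟩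
  | some (.goto j) => ⟨j, c.regs⟩
  | some (.pop k jt jf jn) =>
    match c.regs k with
    | [] => ⟨jn, c.regs⟩
    | true :: w => ⟨jt, Function.update c.regs k w⟩
    | false :: w => ⟨jf, Function.update c.regs k w⟩

/-- A halted configuration is a fixed point of `step`. [folklore] -/
theorem step_of_le {c : SCfg K} (h : P.length ≤ c.pc) : P.step c = c := by
  unfold step
  rw [List.getElem?_eq_none_iff.2 h]

/-- Hence of all its iterates. [folklore] -/
theorem iterate_step_of_le {c : SCfg K} (h : P.length ≤ c.pc) (t : ℕ) : P.step^[t] c = c :=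
  Function.iterate_fixed (P.step_of_le h) t

/-! ### The tape encoding of configurations -/

/-- Tape symbols for a program of length `n`: a program-counter symbol (values `0, …, n`, the
value `n` meaning "halted"), bits, and the register separator. [folklore] -/
inductive SSym (n : ℕ) where
  | lbl (i : Fin (n + 1)) : SSym n
  | bit (b : Bool) : SSym n
  | sep : SSym n
  deriving DecidableEq, Fintype

/-- The separator as the default symbol. [folklore] -/
instance (n : ℕ) : Inhabited (SSym n) := ⟨SSym.sep⟩

/-- The clamped program counter `min j n` as an element of `Fin (n + 1)`. [folklore] -/
def clampPc (n j : ℕ) : Fin (n + 1) := ⟨min j n, by omega⟩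

/-- Value of the clamped program counter. [folklore] -/
@[simp] theorem clampPc_val (n j : ℕ) : (clampPc n j).val = min j n := rfl

/-- The tape word of one register: a separator followed by the bits (top first). [folklore] -/
def regWord {n : ℕ} (w : List Bool) : List (SSym n) := SSym.sep :: w.map SSym.bit

/-- The tape word of a list of registers. [folklore] -/
def regsWord {n : ℕ} (ws : List (List Bool)) : List (SSym n) := ws.flatMap regWord

/-- No registers, empty word. [folklore] -/
@[simp] theorem regsWord_nil {n : ℕ} : (regsWord [] : List (SSym n)) = [] := rfl

/-- The word of `w :: ws`. [folklore] -/
@[simp] theorem regsWord_cons {n : ℕ} (w : List Bool) (ws : List (List Bool)) :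
    (regsWord (w :: ws) : List (SSym n)) = regWord w ++ regsWord ws := rfl

/-- Length of a register word. [folklore] -/
@[simp] theorem length_regWord {n : ℕ} (w : List Bool) :
    (regWord w : List (SSym n)).length = w.length + 1 := by
  simp [regWord]

/-- **The encoding of a configuration**: the clamped program counter, then the registers in
order, each as separator + bits. [folklore] -/
def enc (c : SCfg K) : List (SSym P.length) :=
  SSym.lbl (clampPc P.length c.pc) :: regsWord (List.ofFn c.regs)

/-- Instruction fetch is invariant under clamping the program counter. [folklore] -/
theorem getElem?_clamp (pc : ℕ) : P[min pc P.length]? = P[pc]? := by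
  rcases lt_or_ge pc P.length with h | h
  · rw [Nat.min_eq_left h.le]
  · rw [Nat.min_eq_right h, List.getElem?_eq_none_iff.2 le_rfl, List.getElem?_eq_none_iff.2 h]

/-! ### One step as a finite-state transduction -/

section FSTStep

/-- States of the one-step transducer: the program-counter symbol read (if any), the number of
separators read so far, and the bit popped so far (if any). [folklore] -/
abbrev StepSt (K n : ℕ) : Type := Option (Fin (n + 1)) × Fin (K + 1) × Option Bool

/-- Saturating successor on `Fin (K + 1)` (the separator counter). [folklore] -/
def succSat (c : Fin (K + 1)) : Fin (K + 1) :=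
  if h : c.val + 1 < K + 1 then ⟨c.val + 1, h⟩ else c

/-- Below saturation `succSat` is the successor. [folklore] -/
theorem succSat_val {c : Fin (K + 1)} (h : c.val + 1 ≤ K) : (succSat c).val = c.val + 1 := by
  simp [succSat, show c.val + 1 < K + 1 by omega]

/-- The extra symbol emitted right after the `c`-th separator: the pushed bit, if the
instruction is `push k b` with `k + 1 = c`. [folklore] -/
def pushEmit {n : ℕ} (ins : Option (SInstr K)) (c : ℕ) : List (SSym n) :=
  match ins with
  | some (.push k b) => if k.val + 1 = c then [SSym.bit b] else []
  | _ => []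

/-- Whether the next bit is to be popped: the instruction is `pop k …`, we are inside register
`k` (i.e. `k + 1` separators have been read) and nothing has been popped yet. [folklore] -/
def popHere (ins : Option (SInstr K)) (c : ℕ) (f : Option Bool) : Bool :=
  match ins with
  | some (.pop k _ _ _) => decide (k.val + 1 = c) && f.isNone
  | _ => false

/-- The new (clamped) program counter as a function of the instruction and the popped bit.
[folklore] -/
def nextPc (n : ℕ) (ins : Option (SInstr K)) (i : Fin (n + 1)) (f : Option Bool) : Fin (n + 1) :=
  match ins with
  | none => i
  | some (.push _ _) => clampPc n (i.val + 1)
  | some (.goto j) => clampPc n j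
  | some (.pop _ jt jf jn) =>
    match f with
    | some true => clampPc n jt
    | some false => clampPc n jf
    | none => clampPc n jn

/-- A `pop` instruction pushes nothing. [folklore] -/
theorem pushEmit_eq_nil_of_popHere {n : ℕ} {ins : Option (SInstr K)} {c c' : ℕ} {f : Option Bool}
    (h : popHere ins c f = true) : (pushEmit ins c' : List (SSym n)) = [] := by
  unfold popHere at h
  unfold pushEmit
  split at h <;> simp_all

/-- No instruction, no pop. [folklore] -/
@[simp] theorem popHere_none (c : ℕ) (f : Option Bool) : popHere (none : Option (SInstr K)) c f = false := rfl
/-- `push` does not pop. [folklore] -/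
@[simp] theorem popHere_push (k : Fin K) (b : Bool) (c : ℕ) (f : Option Bool) :
    popHere (some (SInstr.push k b)) c f = false := rfl
/-- `goto` does not pop. [folklore] -/
@[simp] theorem popHere_goto (j c : ℕ) (f : Option Bool) :
    popHere (some (SInstr.goto j : SInstr K)) c f = false := rfl
/-- When `pop k` pops. [folklore] -/
theorem popHere_pop (k : Fin K) (jt jf jn c : ℕ) (f : Option Bool) :
    popHere (some (SInstr.pop k jt jf jn)) c f = (decide (k.val + 1 = c) && f.isNone) := rfl
/-- No instruction, no push. [folklore] -/
@[simp] theorem pushEmit_none {n : ℕ} (c : ℕ) : (pushEmit (none : Option (SInstr K)) c : List (SSym n)) = [] := rfl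
/-- `pop` does not push. [folklore] -/
@[simp] theorem pushEmit_pop {n : ℕ} (k : Fin K) (jt jf jn c : ℕ) :
    (pushEmit (some (SInstr.pop k jt jf jn)) c : List (SSym n)) = [] := rfl
/-- `goto` does not push. [folklore] -/
@[simp] theorem pushEmit_goto {n : ℕ} (j c : ℕ) :
    (pushEmit (some (SInstr.goto j : SInstr K)) c : List (SSym n)) = [] := rfl
/-- What `push k b` pushes, and where. [folklore] -/
theorem pushEmit_push {n : ℕ} (k : Fin K) (b : Bool) (c : ℕ) :
    (pushEmit (some (SInstr.push k b)) c : List (SSym n)) = if k.val + 1 = c then [SSym.bit b] else [] :=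
  rfl

/-- Transition function of the one-step transducer. [folklore] -/
def stepδ (s : StepSt K P.length) (x : SSym P.length) : StepSt K P.length × List (SSym P.length) :=
  match s, x with
  | (none, _, _), .lbl i => ((some i, 0, none), [])
  | (none, c, f), _ => ((none, c, f), [])
  | (some i, c, f), .lbl _ => ((some i, c, f), [])
  | (some i, c, f), .sep => ((some i, succSat c, f), .sep :: pushEmit P[i.val]? (succSat c).val)
  | (some i, c, f), .bit b =>
    if popHere P[i.val]? c.val f then ((some i, c, some b), []) else ((some i, c, f), [.bit b])

/-- **The one-step transducer** of the program `P`: it reads the program-counter symbol, copies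
the registers while inserting the pushed bit after the separator of the target register
(`push`) or dropping — and remembering — the first bit of the target register (`pop`), and
finally prepends the new program-counter symbol. [folklore] -/
def stepFST : FST (StepSt K P.length) (SSym P.length) (SSym P.length) where
  init := (none, 0, none)
  step := P.stepδ
  front s :=
    match s with
    | (some i, _, f) => [.lbl (nextPc P.length P[i.val]? i f)]
    | (none, _, _) => []
  keep _ := true

/-- Initial state of the one-step transducer. [folklore] -/
theorem stepFST_init : P.stepFST.init = (none, 0, none) := rfl
/-- Transition of the one-step transducer. [folklore] -/
theorem stepFST_step (s : StepSt K P.length) (x : SSym P.length) :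
    P.stepFST.step s x = P.stepδ s x := rfl
/-- Final word of the one-step transducer: the new program counter. [folklore] -/
theorem stepFST_front_some (i : Fin (P.length + 1)) (c : Fin (K + 1)) (f : Option Bool) :
    P.stepFST.front (some i, c, f) = [.lbl (nextPc P.length P[i.val]? i f)] := rfl
/-- The one-step transducer keeps its output. [folklore] -/
theorem stepFST_keep (s : StepSt K P.length) : P.stepFST.keep s = true := rfl

/-- What the transducer does on one register block `w` entered with separator count `c`
(after the increment) and pop-flag `f`: new flag and emitted word. [folklore] -/
def blockSpec (n : ℕ) (ins : Option (SInstr K)) (c : ℕ) (f : Option Bool) (w : List Bool) :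
    Option Bool × List (SSym n) :=
  if popHere ins c f then
    match w with
    | [] => (f, [SSym.sep])
    | b :: w' => (some b, SSym.sep :: w'.map SSym.bit)
  else (f, SSym.sep :: (pushEmit ins c ++ w.map SSym.bit))

/-- The same over a list of register blocks, the first entered with count `c + 1`. [folklore] -/
def blocksSpec (n : ℕ) (ins : Option (SInstr K)) : ℕ → Option Bool → List (List Bool) →
    Option Bool × List (SSym n)
  | _, f, [] => (f, [])
  | c, f, w :: ws =>
    ((blocksSpec n ins (c + 1) (blockSpec n ins (c + 1) f w).1 ws).1,
      (blockSpec n ins (c + 1) f w).2 ++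
        (blocksSpec n ins (c + 1) (blockSpec n ins (c + 1) f w).1 ws).2)

/-- No blocks. [folklore] -/
@[simp] theorem blocksSpec_nil (n : ℕ) (ins : Option (SInstr K)) (c : ℕ) (f : Option Bool) :
    blocksSpec n ins c f [] = (f, []) := rfl

/-- One block, then the rest. [folklore] -/
theorem blocksSpec_cons (n : ℕ) (ins : Option (SInstr K)) (c : ℕ) (f : Option Bool) (w : List Bool)
    (ws : List (List Bool)) :
    blocksSpec n ins c f (w :: ws) =
      ((blocksSpec n ins (c + 1) (blockSpec n ins (c + 1) f w).1 ws).1,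
        (blockSpec n ins (c + 1) f w).2 ++
          (blocksSpec n ins (c + 1) (blockSpec n ins (c + 1) f w).1 ws).2) := rfl

/-- A block in which nothing is popped is copied (with the pushed bit in front). [folklore] -/
theorem blockSpec_of_not (n : ℕ) {ins : Option (SInstr K)} {c : ℕ} {f : Option Bool}
    (h : popHere ins c f = false) (w : List Bool) :
    blockSpec n ins c f w = (f, SSym.sep :: (pushEmit ins c ++ w.map SSym.bit)) := by
  simp [blockSpec, h]

/-- Copy phase: while no pop is due, bits are copied and the state is unchanged. [folklore] -/
theorem run_bits (i : Fin (P.length + 1)) (c : Fin (K + 1)) (f : Option Bool)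
    (h : popHere P[i.val]? c.val f = false) (w : List Bool) :
    P.stepFST.run (some i, c, f) (w.map SSym.bit) = ((some i, c, f), w.map SSym.bit) := by
  induction w with
  | nil => rfl
  | cons b w ih =>
    rw [List.map_cons, FST.run_cons]
    have hs : P.stepFST.step (some i, c, f) (SSym.bit b) = ((some i, c, f), [SSym.bit b]) := by
      rw [stepFST_step]
      simp [stepδ, h]
    rw [hs, ih]
    rfl

/-- One register block. [folklore] -/
theorem run_regWord (i : Fin (P.length + 1)) (c : Fin (K + 1)) (f : Option Bool)
    (hc : c.val + 1 ≤ K) (w : List Bool) :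
    P.stepFST.run (some i, c, f) (regWord w) =
      ((some i, succSat c, (blockSpec P.length P[i.val]? (c.val + 1) f w).1),
        (blockSpec P.length P[i.val]? (c.val + 1) f w).2) := by
  have hcv : (succSat c).val = c.val + 1 := succSat_val hc
  rw [regWord, FST.run_cons]
  have hs : P.stepFST.step (some i, c, f) SSym.sep =
      ((some i, succSat c, f), .sep :: pushEmit P[i.val]? (c.val + 1)) := by
    rw [stepFST_step]
    simp [stepδ, hcv]
  rw [hs]
  by_cases hp : popHere P[i.val]? (c.val + 1) f = true
  · have hpe : (pushEmit P[i.val]? (c.val + 1) : List (SSym P.length)) = [] :=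
      pushEmit_eq_nil_of_popHere hp
    cases w with
    | nil => simp [blockSpec, hp, hpe]
    | cons b w =>
      rw [List.map_cons, FST.run_cons]
      have hs' : P.stepFST.step (some i, succSat c, f) (SSym.bit b) =
          ((some i, succSat c, some b), []) := by
        rw [stepFST_step]
        simp [stepδ, hcv, hp]
      rw [hs']
      have hph : popHere P[i.val]? (succSat c).val (some b) = false := by
        unfold popHere; split <;> simp
      rw [P.run_bits i (succSat c) (some b) hph w]
      simp [blockSpec, hp, hpe]
  · rw [Bool.not_eq_true] at hp
    have hph : popHere P[i.val]? (succSat c).val f = false := by rwa [hcv]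
    rw [P.run_bits i (succSat c) f hph w]
    simp [blockSpec, hp]

/-- All register blocks. [folklore] -/
theorem run_regsWord (i : Fin (P.length + 1)) (f : Option Bool) (ws : List (List Bool))
    (c : Fin (K + 1)) (hc : c.val + ws.length ≤ K) :
    P.stepFST.run (some i, c, f) (regsWord ws) =
      ((some i, succSat^[ws.length] c, (blocksSpec P.length P[i.val]? c.val f ws).1),
        (blocksSpec P.length P[i.val]? c.val f ws).2) := by
  induction ws generalizing c f with
  | nil => simp [regsWord]
  | cons w ws ih =>
    have hc1 : c.val + 1 ≤ K := by simp at hc; omega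
    rw [regsWord_cons, FST.run_append, P.run_regWord i c f hc1 w]
    have hcv : (succSat c).val = c.val + 1 := succSat_val hc1
    have hlen : (succSat c).val + ws.length ≤ K := by simp at hc; omega
    rw [ih _ (succSat c) hlen, blocksSpec_cons, hcv, List.length_cons,
      Function.iterate_succ_apply]

/-- The whole run on an encoded configuration. [folklore] -/
theorem eval_enc_aux (c : SCfg K) :
    P.stepFST.eval (P.enc c) =
      SSym.lbl (nextPc P.length P[min c.pc P.length]? (clampPc P.length c.pc)
          (blocksSpec P.length P[min c.pc P.length]? 0 none (List.ofFn c.regs)).1) ::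
        (blocksSpec P.length P[min c.pc P.length]? 0 none (List.ofFn c.regs)).2 := by
  have hstep : P.stepFST.step P.stepFST.init (SSym.lbl (clampPc P.length c.pc)) =
      ((some (clampPc P.length c.pc), 0, none), []) := rfl
  have hrun := P.run_regsWord (clampPc P.length c.pc) none (List.ofFn c.regs) 0 (by simp)
  rw [FST.eval, enc, FST.run_cons, hstep]
  dsimp only
  rw [hrun, stepFST_front_some, stepFST_keep]
  simp

/-! ### The block specification computes `step` -/

/-- Neither `goto` nor a missing instruction changes the registers. [folklore] -/
theorem blocksSpec_copy (n : ℕ) (ins : Option (SInstr K))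
    (hpop : ∀ c f, popHere ins c f = false) (hpush : ∀ c, (pushEmit ins c : List (SSym n)) = [])
    (ws : List (List Bool)) (c : ℕ) (f : Option Bool) :
    blocksSpec n ins c f ws = (f, regsWord ws) := by
  induction ws generalizing c f with
  | nil => rfl
  | cons w ws ih =>
    rw [blocksSpec_cons, blockSpec_of_not n (hpop _ _), ih, hpush]
    simp [regWord]

/-- `push k b` inserts `b` on top of register `k`. [folklore] -/
theorem blocksSpec_push (n : ℕ) (k : Fin K) (b : Bool) (ws : List (List Bool)) (c : ℕ)
    (f : Option Bool) :
    blocksSpec n (some (SInstr.push k b)) c f ws =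
      (f, regsWord (if c ≤ k.val then ws.modify (k.val - c) (b :: ·) else ws)) := by
  induction ws generalizing c with
  | nil => simp
  | cons w ws ih =>
    rw [blocksSpec_cons, blockSpec_of_not n (popHere_push k b _ _), ih, pushEmit_push]
    refine Prod.ext rfl ?_
    dsimp only
    by_cases hkc : k.val + 1 = c + 1
    · have hk : k.val = c := by omega
      simp [hk, regWord]
    · rw [if_neg hkc]
      by_cases hle : c ≤ k.val
      · have hlt : c + 1 ≤ k.val := by omega
        obtain ⟨d, hd⟩ : ∃ d, k.val - c = d + 1 := ⟨k.val - c - 1, by omega⟩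
        have hd' : k.val - (c + 1) = d := by omega
        simp [hle, hlt, hd, hd', regWord]
      · have hlt : ¬(c + 1 ≤ k.val) := by omega
        simp [hle, hlt, regWord]

/-- `pop k` after something has been popped copies the rest. [folklore] -/
theorem blocksSpec_pop_some (n : ℕ) (k : Fin K) (jt jf jn : ℕ) (ws : List (List Bool)) (c : ℕ)
    (x : Bool) :
    blocksSpec n (some (SInstr.pop k jt jf jn)) c (some x) ws = (some x, regsWord ws) := by
  induction ws generalizing c with
  | nil => rfl
  | cons w ws ih =>
    have h : popHere (some (SInstr.pop k jt jf jn)) (c + 1) (some x) = false := by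
      simp [popHere_pop]
    rw [blocksSpec_cons, blockSpec_of_not n h, ih, pushEmit_pop]
    simp [regWord]

/-- `pop k` removes and returns the top bit of register `k` (nothing if it is empty).
[folklore] -/
theorem blocksSpec_pop (n : ℕ) (k : Fin K) (jt jf jn : ℕ) (ws : List (List Bool)) (c : ℕ) :
    blocksSpec n (some (SInstr.pop k jt jf jn)) c none ws =
      (if c ≤ k.val then (ws[k.val - c]?).bind List.head? else none,
        regsWord (if c ≤ k.val then ws.modify (k.val - c) List.tail else ws)) := by
  induction ws generalizing c with
  | nil => simp
  | cons w ws ih =>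
    rw [blocksSpec_cons]
    by_cases hkc : k.val + 1 = c + 1
    · have hk : k.val = c := by omega
      have hph : popHere (some (SInstr.pop k jt jf jn)) (c + 1) none = true := by
        simp [popHere_pop, hkc]
      cases w with
      | nil =>
        simp only [blockSpec, hph, ↓reduceIte, ih]
        simp [hk, regWord]
      | cons b w =>
        simp only [blockSpec, hph, ↓reduceIte, blocksSpec_pop_some]
        simp [hk, regWord]
    · have hk : k.val ≠ c := fun h => hkc (by rw [h])
      have hph : popHere (some (SInstr.pop k jt jf jn)) (c + 1) none = false := by
        simp [popHere_pop, hk]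
      rw [blockSpec_of_not n hph, ih, pushEmit_pop]
      by_cases hle : c ≤ k.val
      · have hlt : c + 1 ≤ k.val := by omega
        obtain ⟨d, hd⟩ : ∃ d, k.val - c = d + 1 := ⟨k.val - c - 1, by omega⟩
        have hd' : k.val - (c + 1) = d := by omega
        simp [hle, hlt, hd, hd', regWord]
      · have hlt : ¬(c + 1 ≤ k.val) := by omega
        simp [hle, hlt, regWord]

/-- `List.ofFn` and `Function.update`: updating the function modifies the list. [folklore] -/
theorem ofFn_update {α : Type} (R : Fin K → α) (k : Fin K) (g : α → α) :
    (List.ofFn R).modify k.val g = List.ofFn (Function.update R k (g (R k))) := by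
  apply List.ext_getElem
  · simp
  · intro j h₁ h₂
    rw [List.getElem_modify, List.getElem_ofFn, List.getElem_ofFn]
    simp only [List.length_modify, List.length_ofFn] at h₁
    by_cases hj : k.val = j
    · have : k = ⟨j, h₁⟩ := Fin.ext hj
      subst this
      simp
    · have : (⟨j, h₁⟩ : Fin K) ≠ k := fun h => hj (by rw [← h])
      simp [hj, Function.update_of_ne this]

/-- **The one-step transducer computes `step`** on encoded configurations. [folklore] -/
theorem stepFST_eval (c : SCfg K) : P.stepFST.eval (P.enc c) = P.enc (P.step c) := by
  rw [P.eval_enc_aux c, P.getElem?_clamp]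
  obtain ⟨pc, R⟩ := c
  simp only [enc, step]
  cases hins : P[pc]? with
  | none =>
    rw [blocksSpec_copy _ _ (fun _ _ => rfl) (fun _ => rfl)]
    simp [nextPc]
  | some ins =>
    have hpc : pc < P.length := (List.getElem?_eq_some_iff.1 hins).1
    have hcl : (clampPc P.length pc).val = pc := by simp [hpc.le]
    cases ins with
    | goto j =>
      rw [blocksSpec_copy _ _ (fun _ _ => rfl) (fun _ => rfl)]
      simp [nextPc]
    | push k b =>
      rw [blocksSpec_push]
      simp only [Nat.zero_le, ↓reduceIte, Nat.sub_zero, nextPc, hcl]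
      rw [ofFn_update]
    | pop k jt jf jn =>
      rw [blocksSpec_pop]
      simp only [Nat.zero_le, ↓reduceIte, Nat.sub_zero, ofFn_update]
      rw [List.getElem?_ofFn]
      cases hR : R k with
      | nil =>
        have hupd : Function.update R k [] = R := by
          rw [← hR]; exact Function.update_eq_self k R
        simp [nextPc, hR, hupd]
      | cons x w =>
        cases x <;> simp [nextPc, hR]

end FSTStep

/-! ### Polynomial time and length growth of one step -/

/-- Re-indexing a polynomial-time computation along maps compatible with the encodings: if `F`
is polynomial-time from `ea'` to `eb'`, `ea = ea' ∘ g` and `eb ∘ f = eb' ∘ F ∘ g`, then `f` is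
polynomial-time from `ea` to `eb` (same machine, same polynomial). [folklore] -/
theorem _root_.Literature.Computability.Complexity.PolyTimeComputable.of_encode {α β α' β' Γ₀ Γ₁ : Type}
    {ea' : α' → List Γ₀} {eb' : β' → List Γ₁} {F : α' → β'} (hF : PolyTimeComputable ea' eb' F)
    {ea : α → List Γ₀} {eb : β → List Γ₁} {f : α → β} (g : α → α')
    (hin : ∀ a, ea a = ea' (g a)) (hout : ∀ a, eb' (F (g a)) = eb (f a)) :
    PolyTimeComputable ea eb f := by
  obtain ⟨p, M, hM⟩ := hF
  refine ⟨p, M, fun a => ?_⟩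
  have h := hM (g a)
  dsimp only at h ⊢
  rw [← hin, hout] at h
  exact h

/-- **One step of a stack register machine is polynomial-time** (indeed linear-time) on encoded
configurations. [Minsky 1967, §14.1; folklore] [folklore] -/
theorem polyTime_step : PolyTimeComputable P.enc P.enc P.step :=
  P.stepFST.polyTimeComputable_eval.of_encode P.enc (fun _ => rfl) fun c => P.stepFST_eval c

/-- Modifying one register by a map that lengthens it by at most one lengthens the tape word by
at most one. [folklore] -/
theorem length_regsWord_modify_le {n : ℕ} (g : List Bool → List Bool)
    (hg : ∀ w, (g w).length ≤ w.length + 1) (ws : List (List Bool)) (j : ℕ) :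
    (regsWord (n := n) (ws.modify j g)).length ≤ (regsWord (n := n) ws).length + 1 := by
  induction ws generalizing j with
  | nil => simp
  | cons w ws ih =>
    cases j with
    | zero => have := hg w; simp; omega
    | succ j => have := ih j; simp at this ⊢; omega

/-- **One step lengthens the encoding by at most one symbol.** [folklore] -/
theorem length_enc_step_le (c : SCfg K) : (P.enc (P.step c)).length ≤ (P.enc c).length + 1 := by
  obtain ⟨pc, R⟩ := c
  unfold step
  split
  · simp
  · rename_i k b _
    simp only [enc, List.length_cons]
    have := length_regsWord_modify_le (n := P.length) (List.cons b) (fun w => by simp)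
      (List.ofFn R) k.val
    rw [ofFn_update] at this
    omega
  · simp [enc]
  · rename_i k jt jf jn _
    split
    · simp [enc]
    · rename_i w hR
      dsimp only at hR ⊢
      simp only [enc, List.length_cons]
      have := length_regsWord_modify_le (n := P.length) List.tail
        (fun w => by simp; omega) (List.ofFn R) k.val
      rw [ofFn_update, hR, List.tail_cons] at this
      omega
    · rename_i w hR
      dsimp only at hR ⊢
      simp only [enc, List.length_cons]
      have := length_regsWord_modify_le (n := P.length) List.tail
        (fun w => by simp; omega) (List.ofFn R) k.val
      rw [ofFn_update, hR, List.tail_cons] at this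
      omega

end SProg

/-! ### The clocked run of a program is in `FP` -/

namespace SProg

variable {K' : ℕ} (P : SProg (K' + 1))

/-- The initial configuration on input `z`: program counter `0`, `z` in the last register,
all other registers empty. [Minsky 1967, §11.1] [folklore] -/
def init (z : List Bool) : SCfg (K' + 1) :=
  ⟨0, fun k => if k = Fin.last K' then z else []⟩

/-- The initial program counter is `0`. [folklore] -/
@[simp] theorem init_pc (z : List Bool) : (init z : SCfg (K' + 1)).pc = 0 := rfl

/-- The input sits in the last register. [folklore] -/
@[simp] theorem init_regs_last (z : List Bool) : (init z : SCfg (K' + 1)).regs (Fin.last K') = z := by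
  simp [init]

/-- All other registers are initially empty. [folklore] -/
theorem init_regs_of_ne_last (z : List Bool) {k : Fin (K' + 1)} (hk : k ≠ Fin.last K') :
    (init z : SCfg (K' + 1)).regs k = [] := by
  simp [init, hk]

/-- The initial registers as a list. [folklore] -/
theorem ofFn_init_regs (z : List Bool) :
    List.ofFn (init z : SCfg (K' + 1)).regs = List.replicate K' [] ++ [z] := by
  rw [List.ofFn_succ']
  have h : (fun i : Fin K' => (init z : SCfg (K' + 1)).regs i.castSucc) = fun _ => [] := by
    funext i
    exact init_regs_of_ne_last z (Fin.castSucc_lt_last i).ne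
  simp [h, List.ofFn_const]

/-- Empty registers encode as separators only. [folklore] -/
theorem regsWord_replicate_nil {n : ℕ} (m : ℕ) :
    (regsWord (List.replicate m []) : List (SSym n)) = List.replicate m SSym.sep := by
  induction m with
  | zero => rfl
  | succ m ih => rw [List.replicate_succ, regsWord_cons, ih]; rfl

/-- The encoding of the initial configuration. [folklore] -/
theorem enc_init (z : List Bool) :
    P.enc (init z) = SSym.lbl (clampPc P.length 0) ::
      (List.replicate (K' + 1) SSym.sep ++ z.map SSym.bit) := by
  rw [enc, ofFn_init_regs, regsWord, List.flatMap_append, ← regsWord, regsWord_replicate_nil]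
  simp [regWord, List.replicate_succ']

/-! #### Stage 1: doubling the input -/

/-- `dbl z`: every bit doubled (so that `boolUnpair (dbl z) = (z, [])`). [folklore] -/
def dbl (z : List Bool) : List Bool := z.flatMap fun b => [b, b]

/-- Doubling the empty word. [folklore] -/
@[simp] theorem dbl_nil : dbl [] = [] := rfl
/-- Doubling a nonempty word. [folklore] -/
@[simp] theorem dbl_cons (b : Bool) (z : List Bool) : dbl (b :: z) = b :: b :: dbl z := rfl

/-- Doubling doubles the length. [folklore] -/
@[simp] theorem length_dbl (z : List Bool) : (dbl z).length = 2 * z.length := by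
  induction z with
  | nil => rfl
  | cons b z ih => simp [ih]; omega

/-- A doubled word unpairs to itself and the empty second component. [Arora–Barak 2009, §0.1]
[folklore] -/
@[simp] theorem boolUnpair_dbl (z : List Bool) : boolUnpair (dbl z) = (z, []) := by
  induction z with
  | nil => rfl
  | cons b z ih => simp [boolUnpair, ih]

/-- The doubling transducer. [folklore] -/
def dblFST : FST Unit Bool Bool where
  init := ()
  step _ b := ((), [b, b])
  front _ := []
  keep _ := true

/-- The run of the doubling transducer. [folklore] -/
theorem dblFST_run (z : List Bool) : dblFST.run () z = ((), dbl z) := by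
  induction z with
  | nil => rfl
  | cons b z ih => rw [FST.run_cons]; simp [dblFST] at ih ⊢; rw [ih]

/-- The doubling transducer computes `dbl`. [folklore] -/
theorem dblFST_eval : dblFST.eval = dbl := by
  funext z
  rw [FST.eval, show dblFST.init = () from rfl, dblFST_run]
  rfl

/-- Doubling is in `FP`. [folklore] -/
theorem dbl_mem_FP : dbl ∈ FP := by
  rw [← dblFST_eval]; exact dblFST.polyTimeComputable_eval

/-! #### Stage 2–3: the unary clock and the initial layout -/

/-- Phases of the layout transducer: first unary block, second unary block, un-doubling. [folklore] -/
inductive LayPh where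
  | pa | pb | pc0
  | pc1 (x : Bool)
  deriving DecidableEq, Fintype

/-- The head of the laid-out configuration: program counter `0` and `K' + 1` separators (all
registers but the last are empty; the last one follows). [folklore] -/
def layHead (K' n : ℕ) : List (Option (SSym n)) :=
  some (SSym.lbl (clampPc n 0)) :: List.replicate (K' + 1) (some SSym.sep)

/-- Transition function of the layout transducer. [folklore] -/
def layδ (K' n : ℕ) : LayPh → Bool → LayPh × List (Option (SSym n))
  | .pa, true => (.pa, [none])
  | .pa, false => (.pb, [])
  | .pb, true => (.pb, [none])
  | .pb, false => (.pc0, layHead K' n)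
  | .pc0, x => (.pc1 x, [])
  | .pc1 x, _ => (.pc0, [some (SSym.bit x)])

/-- **The layout transducer**: on `1ᵐ 0 1ᵗ 0 (dbl z)` it emits `m + t` clock symbols `none`,
the head `layHead`, and the bits of `z` — i.e. the input word of the clocked loop for the
initial configuration `init z` and `m + t` iterations. [folklore] -/
def layFST (K' n : ℕ) : FST LayPh Bool (Option (SSym n)) where
  init := .pa
  step := layδ K' n
  front _ := []
  keep _ := true

/-- First unary block: one clock symbol per `1`. [folklore] -/
theorem layFST_run_pa (n m : ℕ) (rest : List Bool) :
    (layFST K' n).run .pa (ones m ++ false :: rest) =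
      (((layFST K' n).run .pb rest).1, List.replicate m none ++ ((layFST K' n).run .pb rest).2) := by
  induction m with
  | zero => simp [layFST, layδ]
  | succ m ih =>
    rw [show ones (m + 1) ++ false :: rest = true :: (ones m ++ false :: rest) by
      simp [ones, List.replicate_succ]]
    rw [FST.run_cons, show (layFST K' n).step LayPh.pa true = (.pa, [none]) from rfl]
    dsimp only
    rw [ih]
    simp [List.replicate_succ]

/-- Second unary block: one clock symbol per `1`, then the head of the configuration. [folklore] -/
theorem layFST_run_pb (n t : ℕ) (rest : List Bool) :
    (layFST K' n).run .pb (ones t ++ false :: rest) =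
      (((layFST K' n).run .pc0 rest).1,
        List.replicate t none ++ (layHead K' n ++ ((layFST K' n).run .pc0 rest).2)) := by
  induction t with
  | zero => simp [layFST, layδ]
  | succ t ih =>
    rw [show ones (t + 1) ++ false :: rest = true :: (ones t ++ false :: rest) by
      simp [ones, List.replicate_succ]]
    rw [FST.run_cons, show (layFST K' n).step LayPh.pb true = (.pb, [none]) from rfl]
    dsimp only
    rw [ih]
    simp [List.replicate_succ]

/-- Un-doubling phase: the bits of the input register. [folklore] -/
theorem layFST_run_pc0 (n : ℕ) (z : List Bool) :
    (layFST K' n).run .pc0 (dbl z) = (.pc0, z.map fun b => some (SSym.bit b)) := by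
  induction z with
  | nil => rfl
  | cons b z ih =>
    rw [dbl_cons, FST.run_cons, show (layFST K' n).step LayPh.pc0 b = (.pc1 b, []) from rfl]
    dsimp only
    rw [FST.run_cons, show (layFST K' n).step (LayPh.pc1 b) b = (.pc0, [some (SSym.bit b)]) from rfl]
    dsimp only
    rw [ih]
    simp

/-- The layout transducer on the clock word of `z`. [folklore] -/
theorem layFST_eval_hdr (m t : ℕ) (z : List Bool) :
    (layFST K' P.length).eval (hdr m t (dbl z)) =
      List.replicate (m + t) none ++ (P.enc (init z)).map some := by
  rw [FST.eval, show (layFST K' P.length).init = LayPh.pa from rfl, hdr, layFST_run_pa,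
    layFST_run_pb, layFST_run_pc0, enc_init]
  simp [layFST, layHead, ← List.replicate_append_replicate]

/-! #### Stage 5: reading off the output register -/

/-- Transition function of the output transducer (count separators, copy the bits of register
`out`). [folklore] -/
def outδ {n : ℕ} (out : Fin (K' + 1)) : Fin (K' + 2) → SSym n → Fin (K' + 2) × List Bool
  | c, .sep => (succSat c, [])
  | c, .bit b => (c, if c.val = out.val + 1 then [b] else [])
  | c, .lbl _ => (c, [])

/-- **The output transducer**: extracts register `out` from an encoded configuration.
[folklore] -/
def outFST (n : ℕ) (out : Fin (K' + 1)) : FST (Fin (K' + 2)) (SSym n) Bool where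
  init := 0
  step := outδ out
  front _ := []
  keep _ := true

/-- Specification of the output transducer on register blocks entered with count `c`. [folklore] -/
def outSpec (o : ℕ) : ℕ → List (List Bool) → List Bool
  | _, [] => []
  | c, w :: ws => (if c = o then w else []) ++ outSpec o (c + 1) ws

/-- Past the output register nothing is emitted. [folklore] -/
theorem outSpec_of_lt (o : ℕ) (ws : List (List Bool)) {c : ℕ} (h : o < c) : outSpec o c ws = [] := by
  induction ws generalizing c with
  | nil => rfl
  | cons w ws ih => simp [outSpec, ih (Nat.lt_succ_of_lt h), (Nat.ne_of_lt h).symm]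

/-- The output specification returns the block of the output register. [folklore] -/
theorem outSpec_eq_getElem (o : ℕ) (ws : List (List Bool)) {c : ℕ} (hc : c ≤ o)
    (ho : o < c + ws.length) : outSpec o c ws = ws[o - c]'(by omega) := by
  induction ws generalizing c with
  | nil => simp at ho; omega
  | cons w ws ih =>
    rw [outSpec]
    by_cases hco : c = o
    · subst hco
      simp [outSpec_of_lt c ws (Nat.lt_succ_self c)]
    · have hlt : c + 1 ≤ o := by omega
      rw [if_neg hco, List.nil_append, ih hlt (by simp at ho; omega)]
      obtain ⟨d, hd⟩ : ∃ d, o - c = d + 1 := ⟨o - c - 1, by omega⟩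
      simp [hd, show o - (c + 1) = d by omega]

/-- Bits are copied exactly inside the output register. [folklore] -/
theorem outFST_run_bits (n : ℕ) (out : Fin (K' + 1)) (c : Fin (K' + 2)) (w : List Bool) :
    (outFST n out).run c (w.map SSym.bit) = (c, if c.val = out.val + 1 then w else []) := by
  induction w with
  | nil => simp
  | cons b w ih =>
    rw [List.map_cons, FST.run_cons,
      show (outFST n out).step c (SSym.bit b) = (c, if c.val = out.val + 1 then [b] else []) from rfl]
    dsimp only
    rw [ih]
    split <;> simp

/-- The output transducer on register blocks. [folklore] -/
theorem outFST_run_regsWord (n : ℕ) (out : Fin (K' + 1)) (ws : List (List Bool)) (c : Fin (K' + 2))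
    (hc : c.val + ws.length ≤ K' + 1) :
    (outFST n out).run c (regsWord ws) = (succSat^[ws.length] c, outSpec (out.val + 1) (c.val + 1) ws) := by
  induction ws generalizing c with
  | nil => simp [outSpec]
  | cons w ws ih =>
    have hc1 : c.val + 1 ≤ K' + 1 := by simp at hc; omega
    have hcv : (succSat c).val = c.val + 1 := succSat_val hc1
    rw [regsWord_cons, FST.run_append, regWord, FST.run_cons,
      show (outFST n out).step c SSym.sep = (succSat c, []) from rfl]
    dsimp only
    rw [outFST_run_bits, ih (succSat c) (by simp at hc; omega), hcv, outSpec, List.length_cons,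
      Function.iterate_succ_apply]
    simp

/-- **The output transducer extracts register `out`.** [folklore] -/
theorem outFST_eval (out : Fin (K' + 1)) (c : SCfg (K' + 1)) :
    (outFST P.length out).eval (P.enc c) = c.regs out := by
  rw [FST.eval, show (outFST P.length out).init = 0 from rfl, enc, FST.run_cons,
    show (outFST P.length out).step 0 (SSym.lbl (clampPc P.length c.pc)) = (0, []) from rfl]
  dsimp only
  rw [outFST_run_regsWord _ _ _ _ (by simp)]
  simp only [outFST, ↓reduceIte, List.nil_append, Fin.val_zero, zero_add]
  rw [outSpec_eq_getElem _ _ (by omega) (by simp; omega), List.getElem_ofFn]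
  congr 1

/-! #### Assembly -/

/-- **Stack register programs run in polynomial time on `TM2`.** For every program `P` on
`K' + 1` registers, output register `out` and polynomial `T`, the string function
`z ↦ (register out after |z| + T(|z|) steps from init z)` is in `FP`. [Minsky 1967, §11.1,
§14.1 (the model); Arora–Barak 2009, §1.3–1.4 (polynomial simulation, clocking)] [folklore] -/
theorem outputFn_mem_FP (out : Fin (K' + 1)) (T : Polynomial ℕ) :
    (fun z => (P.step^[z.length + T.eval z.length] (init z)).regs out) ∈ FP := by
  -- stages 1–3: from `z` to the input word of the clocked loop
  have h1 : PolyTimeComputable (id : List Bool → List Bool) (id : List (Option (SSym P.length)) → _)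
      ((layFST K' P.length).eval ∘ (evalHdrFn T ∘ dbl)) :=
    PolyTimeComputable.comp_holds (layFST K' P.length).polyTimeComputable_eval
      (PolyTimeComputable.comp_holds (evalHdrFn_mem_FP T) dbl_mem_FP)
  have h2 : PolyTimeComputable (id : List Bool → List Bool)
      (fun q : SCfg (K' + 1) × ℕ => List.replicate q.2 none ++ (P.enc q.1).map some)
      (fun z => (init z, z.length + T.eval z.length)) := by
    refine h1.of_encode id (fun _ => rfl) fun z => ?_
    simp only [Function.comp_apply, id_eq, evalHdrFn, boolUnpair_dbl]
    exact P.layFST_eval_hdr z.length (T.eval z.length) z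
  -- stage 4: the clocked loop
  have h3 := PolyTimeComputable.iterate_of_le_add 1 P.length_enc_step_le P.polyTime_step
  have h4 := PolyTimeComputable.comp_holds h3 h2
  -- stage 5: the output register
  have h5 : PolyTimeComputable P.enc (id : List Bool → List Bool) fun c : SCfg (K' + 1) => c.regs out :=
    (outFST P.length out).polyTimeComputable_eval.of_encode P.enc (fun _ => rfl) fun c =>
      P.outFST_eval out c
  exact PolyTimeComputable.comp_holds h5 h4

end SProg

end Literature.Computability.Complexity
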